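import Summits.AtomisticToContinuum.HydrodynamicLimit.Theorems.JParityClosureRateFloorLineDefs
import Literature.MathematicalPhysics.KineticTheory.HardSphereTwoTimePressure
import Literature.MathematicalPhysics.KineticTheory.HardSphereEuler
import Summits.AtomisticToContinuum.HydrodynamicLimit.Theorems.OneFlightGossipEngineEnergyCurrentTailsFirstPartnerObjects
import HarnessLib

/-!
# QMF₄ᴸ from the anchored window mixing-rate floor — glue G2, offset averaging

Stub `stub_quarticMixingFloor4L_of_windowRateFloor` of the line `quartic-schur-ledger` of the crux
`EnergyCurrentTails` (stmt-AtomisticToContinuum-9235; seat c6, reshape B).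

**What is proved.** The registered stub `stub_quarticMixingFloor4L_of_windowRateFloor :
WindowMixingRateFloorOne → QuarticMixingFloor4L`: the ANCHORED ONE-LOOK-AHEAD floor W′ (one ratio
`0 < τ₁ ≤ 1/4`; `c σ²(N+1)^{1/3} τ₁h_N · E[fastQuarticAvg at the anchor a] ≤ E[mixingFlux over (a, a + τ₁h_N]]`
for every anchor `0 ≤ a`, `a + τ₁h_N ≤ T`, `h_N = (N+1)^{-1/3}`) implies the LAGGED KINETIC-WINDOW floor QMF₄ᴸ
(`c σ²(N+1)^{1/3} ∫_{(s, s + h_N/2]} E[fastQuarticAvg] ≤ E[mixingFlux over (s, s + h_N]]`), with the SAME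
constants `σ₀, K₀, c, N₀`.  Corollaries: W → W′ (`windowMixingRateFloorOne_of_windowMixingRateFloor`, take
`τ₁ := min τ₀ (1/4)`) and hence W → QMF₄ᴸ (`quarticMixingFloor4L_of_windowMixingRateFloor`) for the
every-look-ahead floor `WindowMixingRateFloor`.

**Proof (offset averaging; no Tonelli, no measurability in time).** Fix `N ≥ N₀` and `s`; cells of length
`Δ := τ₁ h_N` and the count `K := ⌊τ₁⁻¹ - 1⌋₊`, so that `(K+1)Δ ≤ h_N` and `h_N/2 ≤ KΔ` (as `τ₁ ≤ 1/4`).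
* (a) Pointwise in the offset `θ ∈ (0, Δ]`: the sub-windows `S_k(θ) = (s + θ + kΔ, s + θ + (k+1)Δ]`,
  `k < K`, are pairwise disjoint, contained in `(s, s + h_N]`, with admissible anchors; W′ at each anchor,
  superadditivity of the lower integral (`MeasureTheory.le_lintegral_add`) and, on the good set of the
  flow (`ae_mem_good_localGibbsLaw`, finitely many collisions per bounded window,
  `HardSphereFlow.finite_collisionTimes_inter`), the pathwise bound `Σ_k mixingFlux(S_k) ≤
  mixingFlux((s, s + h_N])` (nonnegative marks, disjoint finite index sets) give
  `ofReal(cνΔ) Σ_{k<K} E[fastQuarticAvg at s + θ + kΔ] ≤ E[mixingFlux over (s, s + h_N]]`.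
* (b) Average over `θ ∈ (0, Δ]` (Lebesgue): the right side picks up the factor `ofReal Δ`
  (`setLIntegral_const`, `Real.volume_Ioc`); on the left, superadditivity again and
* (c)+(d) translation invariance of Lebesgue measure (`measurePreserving_add_right`) and additivity over
  adjacent intervals (`lintegral_union`, `Set.Ioc_union_Ioc_eq_Ioc`) turn `Σ_k ∫_{(0,Δ]} f(s + θ + kΔ) dθ`
  into `∫_{(s, s + KΔ]} f ⊇ ∫_{(s, s + h_N/2]} f` — valid for EVERY `f : ℝ → ℝ≥0∞`.
* (e) Cancel `ofReal Δ` (`ENNReal.mul_le_mul_iff_right`).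

**Constants.** `σ₀, K₀, c, N₀` of QMF₄ᴸ are those of W′; `τ₁` only fixes the grid.

References: pure measure-theoretic bookkeeping (Mathlib); the objects are those of
`OneFlightGossipEngineEnergyCurrentTailsFirstPartnerObjects`.
-/

noncomputable section

open MeasureTheory Set Filter
open scoped ENNReal InnerProductSpace BigOperators Classical

namespace Summit.AtomisticToContinuum.HydrodynamicLimit.Theorems.QuarticSchurLedger

open Literature.MathematicalPhysics.KineticTheory Literature.Analysis.FluidPDE
open Summit.AtomisticToContinuum.HydrodynamicLimit.Theorems.RateFloorLine
open Summit.AtomisticToContinuum.HydrodynamicLimit.Theorems.EnergyCurrentTailsFirstPartner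

/-! ## Real-line bookkeeping (valid for every integrand) -/

/-- Superadditivity of the lower Lebesgue integral over a finite sum of ARBITRARY (not necessarily
measurable) integrands: `∑ᵢ ∫⁻ fᵢ ≤ ∫⁻ ∑ᵢ fᵢ` (iterate `MeasureTheory.le_lintegral_add`). -/
private theorem sum_lintegral_le {α ι : Type*} [MeasurableSpace α] (μ : Measure α) (I : Finset ι)
    (f : ι → α → ℝ≥0∞) : ∑ i ∈ I, ∫⁻ x, f i x ∂μ ≤ ∫⁻ x, ∑ i ∈ I, f i x ∂μ := by
  classical
  induction I using Finset.induction_on with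
  | empty => simp
  | insert a s ha ih =>
    simp only [Finset.sum_insert ha]
    exact (add_le_add le_rfl ih).trans (le_lintegral_add _ _)

/-- Sliding a grid of `K` cells of length `Δ` over all offsets: for EVERY `f : ℝ → ℝ≥0∞`,
`∑_{k<K} ∫⁻_{θ ∈ (0, Δ]} f (s + θ + kΔ) = ∫⁻_{(s, s + KΔ]} f` (translation invariance of Lebesgue measure,
`measurePreserving_add_right`, and additivity of set integrals over adjacent intervals, `lintegral_union`). -/
private theorem sum_lintegral_Ioc_translate (f : ℝ → ℝ≥0∞) (s : ℝ) {Δ : ℝ} (hΔ : 0 ≤ Δ) :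
    ∀ K : ℕ, ∑ k ∈ Finset.range K, ∫⁻ θ in Ioc 0 Δ, f (s + θ + k * Δ) =
      ∫⁻ τ in Ioc s (s + K * Δ), f τ
  | 0 => by simp
  | K + 1 => by
    have hshift : ∫⁻ θ in Ioc 0 Δ, f (s + θ + K * Δ) =
        ∫⁻ τ in Ioc (s + K * Δ) (s + K * Δ + Δ), f τ := by
      have key := (measurePreserving_add_right (volume : Measure ℝ) (s + K * Δ))
        |>.setLIntegral_comp_preimage_emb (measurableEmbedding_addRight (s + K * Δ)) f
          (Ioc (s + K * Δ) (s + K * Δ + Δ))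
      rw [Set.preimage_add_const_Ioc, sub_self, add_sub_cancel_left] at key
      rw [← key]
      exact lintegral_congr fun θ => show f _ = f (θ + (s + K * Δ)) from congrArg f (by ring)
    rw [Nat.cast_succ, add_mul, one_mul, ← add_assoc, Finset.sum_range_succ,
      sum_lintegral_Ioc_translate f s hΔ K, hshift,
      ← lintegral_union measurableSet_Ioc (Set.Ioc_disjoint_Ioc_of_le le_rfl),
      Set.Ioc_union_Ioc_eq_Ioc (le_add_of_nonneg_right (by positivity)) (le_add_of_nonneg_right hΔ)]

/-- **Offset averaging (abstract form).** If for every offset `θ ∈ (0, Δ]` and every cell `k < K` the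
anchored bound `ofReal (C Δ) · f (s + θ + kΔ) ≤ F (cell)` holds and the cells' `F`-values add up to at most
`F ((s, s + h])`, and if `h/2 ≤ KΔ`, then `ofReal C · ∫⁻_{(s, s + h/2]} f ≤ F ((s, s + h])` — for EVERY
`f : ℝ → ℝ≥0∞` and set functional `F`. -/
private theorem offset_average {f : ℝ → ℝ≥0∞} {F : Set ℝ → ℝ≥0∞} {C Δ h s : ℝ} {K : ℕ}
    (hΔ : 0 < Δ) (hK : h / 2 ≤ K * Δ)
    (hW : ∀ θ ∈ Ioc 0 Δ, ∀ k ∈ Finset.range K, ENNReal.ofReal (C * Δ) * f (s + θ + k * Δ) ≤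
      F (Ioc (s + θ + k * Δ) (s + θ + k * Δ + Δ)))
    (hF : ∀ θ ∈ Ioc 0 Δ, ∑ k ∈ Finset.range K, F (Ioc (s + θ + k * Δ) (s + θ + k * Δ + Δ)) ≤
      F (Ioc s (s + h))) :
    ENNReal.ofReal C * ∫⁻ τ in Ioc s (s + h / 2), f τ ≤ F (Ioc s (s + h)) := by
  -- (a) pointwise in the offset
  have hpt : ∀ θ ∈ Ioc 0 Δ, ENNReal.ofReal (C * Δ) * ∑ k ∈ Finset.range K, f (s + θ + k * Δ) ≤
      F (Ioc s (s + h)) := fun θ hθ => by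
    rw [Finset.mul_sum]
    exact (Finset.sum_le_sum fun k hk => hW θ hθ k hk).trans (hF θ hθ)
  -- (b) average over the offset: the right-hand side
  have hright : ∫⁻ θ in Ioc 0 Δ, ENNReal.ofReal (C * Δ) * ∑ k ∈ Finset.range K, f (s + θ + k * Δ) ≤
      ENNReal.ofReal Δ * F (Ioc s (s + h)) := by
    refine (setLIntegral_mono' measurableSet_Ioc hpt).trans_eq ?_
    rw [setLIntegral_const, Real.volume_Ioc, sub_zero, mul_comm]
  -- (c)+(d) the left-hand side: superadditivity, translation, gluing, monotonicity in the set
  have hleft : ENNReal.ofReal (C * Δ) * ∫⁻ τ in Ioc s (s + h / 2), f τ ≤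
      ∫⁻ θ in Ioc 0 Δ, ENNReal.ofReal (C * Δ) * ∑ k ∈ Finset.range K, f (s + θ + k * Δ) := by
    rw [lintegral_const_mul' _ _ ENNReal.ofReal_ne_top]
    refine mul_le_mul_right ?_ _
    calc ∫⁻ τ in Ioc s (s + h / 2), f τ ≤ ∫⁻ τ in Ioc s (s + K * Δ), f τ :=
          lintegral_mono_set (Ioc_subset_Ioc_right (by linarith))
      _ = ∑ k ∈ Finset.range K, ∫⁻ θ in Ioc 0 Δ, f (s + θ + k * Δ) :=
          (sum_lintegral_Ioc_translate f s hΔ.le K).symm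
      _ ≤ ∫⁻ θ in Ioc 0 Δ, ∑ k ∈ Finset.range K, f (s + θ + k * Δ) := sum_lintegral_le _ _ _
  -- (e) cancel `ofReal Δ`
  refine (ENNReal.mul_le_mul_iff_right (ENNReal.ofReal_pos.2 hΔ).ne' ENNReal.ofReal_ne_top).1 ?_
  calc ENNReal.ofReal Δ * (ENNReal.ofReal C * ∫⁻ τ in Ioc s (s + h / 2), f τ)
      = ENNReal.ofReal (C * Δ) * ∫⁻ τ in Ioc s (s + h / 2), f τ := by
        rw [← mul_assoc, ← ENNReal.ofReal_mul hΔ.le, mul_comm Δ C]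
    _ ≤ ENNReal.ofReal Δ * F (Ioc s (s + h)) := hleft.trans hright

/-- Grid arithmetic: for a ratio `0 < τ₁ ≤ 1/4` the count `K := ⌊τ₁⁻¹ - 1⌋₊` satisfies `(K + 1) τ₁ ≤ 1`
and `1/2 ≤ K τ₁` (so `K` cells of length `τ₁h` fit in a window `h` and cover at least its first half). -/
private theorem grid_count {τ₁ : ℝ} (h0 : 0 < τ₁) (h4 : τ₁ ≤ 1 / 4) :
    ∃ K : ℕ, ((K : ℝ) + 1) * τ₁ ≤ 1 ∧ 1 / 2 ≤ K * τ₁ := by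
  have hinv : τ₁ * τ₁⁻¹ = 1 := mul_inv_cancel₀ h0.ne'
  have hx : 4 ≤ τ₁⁻¹ := by nlinarith [inv_pos.2 h0]
  refine ⟨⌊τ₁⁻¹ - 1⌋₊, ?_, ?_⟩
  · have hK : (⌊τ₁⁻¹ - 1⌋₊ : ℝ) ≤ τ₁⁻¹ - 1 := Nat.floor_le (by linarith)
    nlinarith [mul_le_mul_of_nonneg_right hK h0.le]
  · have hK : τ₁⁻¹ - 1 < (⌊τ₁⁻¹ - 1⌋₊ : ℝ) + 1 := Nat.lt_floor_add_one _
    nlinarith [mul_le_mul_of_nonneg_right hK.le h0.le]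

/-! ## Pathwise: fluxes of disjoint sub-windows -/

/-- On a window `S` carrying finitely many times of `C`, the `C ∩ ·`-sums of a nonnegative `g` over
pairwise disjoint sub-windows of `S` add up to at most the sum over `S`. -/
private theorem sum_finsum_mem_le {ι : Type*} (I : Finset ι) {C S : Set ℝ} (t : ι → Set ℝ)
    (g : ℝ → ℝ≥0∞) (hfin : (C ∩ S).Finite) (hsub : ∀ i ∈ I, t i ⊆ S)
    (hdisj : (I : Set ι).PairwiseDisjoint t) :
    ∑ i ∈ I, ∑ᶠ τ ∈ C ∩ t i, g τ ≤ ∑ᶠ τ ∈ C ∩ S, g τ := by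
  classical
  have hk : ∀ i ∈ I, C ∩ t i = ↑(hfin.toFinset.filter (· ∈ t i)) := fun i hi => by
    ext τ
    simp only [Finset.coe_filter, Set.Finite.mem_toFinset, mem_inter_iff, mem_setOf_eq]
    exact ⟨fun h => ⟨⟨h.1, hsub i hi h.2⟩, h.2⟩, fun h => ⟨h.1.1, h.2⟩⟩
  calc ∑ i ∈ I, ∑ᶠ τ ∈ C ∩ t i, g τ
      = ∑ i ∈ I, ∑ τ ∈ hfin.toFinset.filter (· ∈ t i), g τ :=
        Finset.sum_congr rfl fun i hi => by rw [hk i hi, finsum_mem_coe_finset]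
    _ = ∑ τ ∈ I.biUnion fun i => hfin.toFinset.filter (· ∈ t i), g τ := by
        refine (Finset.sum_biUnion fun i hi j hj hij => ?_).symm
        exact Finset.disjoint_filter.2 fun x _ hx1 hx2 =>
          Set.disjoint_left.1 (hdisj hi hj hij) hx1 hx2
    _ ≤ ∑ τ ∈ hfin.toFinset, g τ :=
        Finset.sum_le_sum_of_subset (Finset.biUnion_subset.2 fun i _ => Finset.filter_subset _ _)
    _ = ∑ᶠ τ ∈ C ∩ S, g τ := by rw [← finsum_mem_coe_finset, hfin.coe_toFinset]

/-! ## The glue -/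

/-- **G2 · QMF₄ᴸ from the anchored one-look-ahead rate floor W′, by offset averaging** (registered stub of
the line `quartic-schur-ledger`, seat c6 reshape B).  W′ implies QMF₄ᴸ with the same constants: slide a grid
of `K = ⌊τ₁⁻¹ - 1⌋₊` cells of length `Δ = τ₁h_N` across all offsets `θ ∈ (0, Δ]`; each offset gives, by W′ at
the `K` anchors, superadditivity of `∫⁻` and disjointness of the cells' collision sets on the good set of the
flow, a Riemann-type lower bound for `E[mixingFlux over (s, s + h_N]]`; the `θ`-average of these Riemann
sums is `ofReal (c σ²(N+1)^{1/3}) ∫_{(s, s + KΔ]} E[fastQuarticAvg]`, and `(s, s + KΔ] ⊇ (s, s + h_N/2]`. -/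
theorem stub_quarticMixingFloor4L_of_windowRateFloor : WindowMixingRateFloorOne → QuarticMixingFloor4L := by
  intro hW a₀ θ₀ u₀ ha hθ hu ha0 hθ0
  obtain ⟨σ₀, hσ₀, hW⟩ := hW a₀ θ₀ u₀ ha hθ hu ha0 hθ0
  refine ⟨σ₀, hσ₀, fun σ hσ hσ₁ T hT Φ => ?_⟩
  obtain ⟨K₀, hK₀, τ₁, hτ₁, hτ₁4, c, hc, N₀, hW⟩ := hW σ hσ hσ₁ T hT Φ
  refine ⟨K₀, hK₀, c, hc, N₀, fun N hN s hs hsT => ?_⟩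
  obtain ⟨K, hK1, hK2⟩ := grid_count hτ₁ hτ₁4
  have hWN := hW N hN
  have hh : (0 : ℝ) < ((N : ℝ) + 1) ^ (-(1 / 3 : ℝ)) := Real.rpow_pos_of_pos (by positivity) _
  set h : ℝ := ((N : ℝ) + 1) ^ (-(1 / 3 : ℝ)) with hh_def
  set Δ : ℝ := τ₁ * h with hΔ_def
  have hΔ : 0 < Δ := mul_pos hτ₁ hh
  have hKΔ : ((K : ℝ) + 1) * Δ ≤ h := by
    calc ((K : ℝ) + 1) * Δ = ((K : ℝ) + 1) * τ₁ * h := by rw [hΔ_def, mul_assoc]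
      _ ≤ 1 * h := mul_le_mul_of_nonneg_right hK1 hh.le
      _ = h := one_mul h
  have hKΔ' : h / 2 ≤ K * Δ := by
    calc h / 2 = 1 / 2 * h := by ring
      _ ≤ (K : ℝ) * τ₁ * h := mul_le_mul_of_nonneg_right hK2 hh.le
      _ = K * Δ := by rw [hΔ_def, mul_assoc]
  -- anchors of the cells are admissible and the cells lie in the window
  have hcell : ∀ θ ∈ Ioc (0 : ℝ) Δ, ∀ k ∈ Finset.range K,
      0 ≤ s + θ + k * Δ ∧ s + θ + k * Δ + Δ ≤ s + h := by
    intro θ hθ k hk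
    have hk' : (k : ℝ) + 1 ≤ K := by exact_mod_cast Finset.mem_range.1 hk
    have hθ0 := hθ.1
    refine ⟨by positivity, ?_⟩
    nlinarith [mul_le_mul_of_nonneg_right hk' hΔ.le, hθ.2]
  refine offset_average (F := fun S => ∫⁻ z, mixingFlux (Φ N) K₀ S z ∂(localGibbsLaw σ a₀ u₀ θ₀ N (Φ N)))
    hΔ hKΔ' (fun θ hθ k hk => hWN _ (hcell θ hθ k hk).1 ((hcell θ hθ k hk).2.trans hsT))
    fun θ hθ => ?_
  -- the cells' fluxes add up to at most the window's flux: superadditivity, then pathwise on the good set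
  refine (sum_lintegral_le _ _ _).trans (lintegral_mono_ae ?_)
  filter_upwards [ae_mem_good_localGibbsLaw σ a₀ u₀ θ₀ N (Φ N)] with z hz
  unfold mixingFlux
  refine sum_finsum_mem_le (Finset.range K) (fun k => Ioc (s + θ + k * Δ) (s + θ + k * Δ + Δ)) _
    ((Φ N).finite_collisionTimes_inter hz Ioc_subset_Icc_self) (fun k hk => ?_) fun i hi j hj hij => ?_
  · exact Ioc_subset_Ioc (by nlinarith [hθ.1, mul_nonneg (Nat.cast_nonneg (α := ℝ) k) hΔ.le])
      (hcell θ hθ k hk).2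
  · rcases lt_or_gt_of_ne hij with h | h
    · have h' : (i : ℝ) + 1 ≤ j := by exact_mod_cast Nat.lt_iff_add_one_le.1 h
      exact Set.Ioc_disjoint_Ioc_of_le (by nlinarith [mul_le_mul_of_nonneg_right h' hΔ.le])
    · have h' : (j : ℝ) + 1 ≤ i := by exact_mod_cast Nat.lt_iff_add_one_le.1 h
      exact (Set.Ioc_disjoint_Ioc_of_le (by nlinarith [mul_le_mul_of_nonneg_right h' hΔ.le])).symm

/-- **W → W′**: the every-look-ahead anchored floor `WindowMixingRateFloor` implies the one-look-ahead floor
`WindowMixingRateFloorOne` (fix the ratio `τ₁ := min τ₀ (1/4)`, same `σ₀, K₀, c, N₀`). -/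
theorem windowMixingRateFloorOne_of_windowMixingRateFloor :
    WindowMixingRateFloor → WindowMixingRateFloorOne := by
  intro hW a₀ θ₀ u₀ ha hθ hu ha0 hθ0
  obtain ⟨σ₀, hσ₀, hW⟩ := hW a₀ θ₀ u₀ ha hθ hu ha0 hθ0
  refine ⟨σ₀, hσ₀, fun σ hσ hσ₁ T hT Φ => ?_⟩
  obtain ⟨K₀, hK₀, τ₀, hτ₀, c, hc, N₀, hW⟩ := hW σ hσ hσ₁ T hT Φ
  refine ⟨K₀, hK₀, min τ₀ (1 / 4), lt_min hτ₀ (by norm_num), min_le_right _ _, c, hc, N₀,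
    fun N hN a ha haT => hW N hN _ (mul_pos (lt_min hτ₀ (by norm_num)) ?_) ?_ a ha haT⟩
  · exact Real.rpow_pos_of_pos (by positivity) _
  · exact mul_le_mul_of_nonneg_right (min_le_left _ _) (Real.rpow_pos_of_pos (by positivity) _).le

/-- **W → QMF₄ᴸ** (G2 for the every-look-ahead floor `WindowMixingRateFloor`): compose W → W′ with the
registered stub. -/
theorem quarticMixingFloor4L_of_windowMixingRateFloor : WindowMixingRateFloor → QuarticMixingFloor4L :=
  fun hW => stub_quarticMixingFloor4L_of_windowRateFloor (windowMixingRateFloorOne_of_windowMixingRateFloor hW)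

end Summit.AtomisticToContinuum.HydrodynamicLimit.Theorems.QuarticSchurLedger

end
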